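import Summits.ResolutionOfSingularities.ResolutionOfSingularities.Theses.FoliationDescent
import Summits.ResolutionOfSingularities.ResolutionOfSingularities.Theorems.PAlterationPialtBridgeFoliationDescent
import HarnessLib

/-!
# Evidence for crux `DualSandwich` (stmt-ResolutionOfSingularities-17083), line `birth`:
# the load-bearing stub `stub_relStep` (`FolLU → LogCanQuotLU → RelStep p`) PROVED

Refuter crux-attack probe (refuter-rattack-stmt-ResolutionOfSingularities-17083-0): the planner's
only flagged risk for the glue was "a typing slip (the `R ≤ S'` bookkeeping through `FolLU`'s
output `S ≤ S'`)". This file type-checks the RELATIVE, centre-local descent step verbatim as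
`Cruxes/DualSandwich/Lines/birth.lean` states it (`RelStep`, copied byte-for-byte below), from
`FolLU` and `LogCanQuotLU`, by the proof of the landed bridge
`rrLU1_perfect_of_folLU_of_logCanQuotLU` (`Theorems/PAlterationPialtBridgeFoliationDescent.lean`)
with `R = ⊥` replaced by the given `R` (`R.map f ≤ B ≤ S'`, `D = d/dy` kills `R ⊆ K`).
So the two route cruxes DO compose in the relative form the sandwich consumes: no typing slip.
(Candidate proof for a prover / the line lead; a refuter lands nothing positive. Published to the
crux dir as `StubRelStepProof.lean`; refuter folder copy `RelStepProof.lean`.)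
-/

set_option linter.dupNamespace false

noncomputable section

open IsLocalRing
open Summit.ResolutionOfSingularities.ResolutionOfSingularities.Theses.FoliationDescent (FolLU LogCanQuotLU)
open Literature.AlgebraicGeometry.Resolution (isRegularLocalRing_localization_atPrime_congr)
open Summit.ResolutionOfSingularities.ResolutionOfSingularities.Theorems.Pialt.RadiciallyRegular

namespace Summit.ResolutionOfSingularities.ResolutionOfSingularities.Theorems.DualSandwichRefuterEvidence

/-- Verbatim copy of `RelStep` from `Cruxes/DualSandwich/Lines/birth.lean`. -/
def RelStep (p : ℕ) : Prop :=
  ∀ (k K L : Type) [Field k] [CharP k p] [PerfectField k] [Field K] [Field L] [Algebra k K]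
    [Algebra K L] [Algebra k L] [IsScalarTower k K L], IsPurelyInseparable K L →
    (∃ y : L, y ^ p ∈ (algebraMap K L).range ∧ IntermediateField.adjoin K {y} = ⊤) →
    ∀ (O : ValuationSubring L) (B : Subalgebra k L) (hB : B.toSubring ≤ O.toSubring)
      (R : Subalgebra k K), B.FG → IsFractionRing B L →
      IsRegularLocalRing (Localization.AtPrime
        (Ideal.comap (Subring.inclusion hB) (IsLocalRing.maximalIdeal O))) →
      R.FG → R.map (IsScalarTower.toAlgHom k K L) ≤ B →
      ∃ (A : Subalgebra k K) (hA : A.toSubring ≤ (O.comap (algebraMap K L)).toSubring),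
        R ≤ A ∧ A.FG ∧ IsFractionRing A K ∧
        IsRegularLocalRing (Localization.AtPrime
          (Ideal.comap (Subring.inclusion hA)
            (IsLocalRing.maximalIdeal (O.comap (algebraMap K L)))))

/-- Relative transport (the bridge's `isLocallyUniformizable_comap_of_model`, keeping `R`):
an affine model `A ⊆ O` of `K` realised inside `L ⊇ K`, regular at the centre of `O` and
containing the image of `R ⊆ K`, pulls back to a model of `K` inside `O ∩ K` containing `R`,
regular at the centre of `O ∩ K`. [folklore] -/
theorem exists_model_comap_of_model {k K L : Type} [Field k] [Field K] [Field L]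
    [Algebra k K] [Algebra k L] (f : K →ₐ[k] L) (O : ValuationSubring L) (A : Subalgebra k L)
    (hA : A.toSubring ≤ O.toSubring) (hAK : ∀ x ∈ A, x ∈ Set.range f) (hfg : A.FG)
    (hfrac : ∀ z : K, ∃ a b : L, a ∈ A ∧ b ∈ A ∧ b ≠ 0 ∧ f z = a / b)
    (hreg : IsRegularLocalRing (Localization.AtPrime
      (Ideal.comap (Subring.inclusion hA) (maximalIdeal O))))
    (R : Subalgebra k K) (hR : R.map f ≤ A) :
    ∃ (A₀ : Subalgebra k K) (h₀ : A₀.toSubring ≤ (O.comap (f : K →+* L)).toSubring),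
      R ≤ A₀ ∧ A₀.FG ∧ IsFractionRing A₀ K ∧
      IsRegularLocalRing (Localization.AtPrime
        (Ideal.comap (Subring.inclusion h₀) (maximalIdeal (O.comap (f : K →+* L))))) := by
  classical
  have hfinj : Function.Injective f := (f : K →+* L).injective
  set A₀ : Subalgebra k K := A.comap f with hA₀
  have hmap : A₀.map f = A := by
    rw [hA₀, Subalgebra.map_comap_eq]
    exact inf_eq_left.mpr fun x hx => hAK x hx
  have h₀ : A₀.toSubring ≤ (O.comap (f : K →+* L)).toSubring := fun x hx => hA hx
  have hA₀fg : A₀.FG := Subalgebra.fg_of_fg_map _ f hfinj (by rw [hmap]; exact hfg)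
  have hA₀fr : IsFractionRing A₀ K := by
    refine IsFractionRing.of_field A₀ K fun z => ?_
    obtain ⟨a, b, ha, hb, hb0, hz⟩ := hfrac z
    obtain ⟨a₀, rfl⟩ := hAK a ha
    obtain ⟨b₀, rfl⟩ := hAK b hb
    refine ⟨⟨a₀, show f a₀ ∈ A from ha⟩, ⟨b₀, show f b₀ ∈ A from hb⟩, hfinj ?_⟩
    rw [hz, map_div₀]
    rfl
  have hRA₀ : R ≤ A₀ := Subalgebra.map_le.mp hR
  refine ⟨A₀, h₀, hRA₀, hA₀fg, hA₀fr, ?_⟩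
  -- transport of the local ring at the centre along `A₀ ≅ A₀.map f = A`
  have hmapS : A₀.toSubring.map (f : K →+* L) = A.toSubring := by
    ext z
    simp only [Subring.mem_map, Subalgebra.mem_toSubring]
    constructor
    · rintro ⟨x, hx, rfl⟩
      exact hx
    · intro hz
      obtain ⟨x, rfl⟩ := hAK z hz
      exact ⟨x, hz, rfl⟩
  let e : A₀.toSubring ≃+* A.toSubring :=
    (A₀.toSubring.equivMapOfInjective (f : K →+* L) hfinj).trans (RingEquiv.subringCongr hmapS)
  have he : ∀ a : A₀.toSubring, ((e a : A.toSubring) : L) = f a := fun a => rfl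
  set P : Ideal A.toSubring := Ideal.comap (Subring.inclusion hA) (maximalIdeal O) with hP
  haveI hPp : P.IsPrime := Ideal.comap_isPrime _ _
  have hPe : P.comap (e : A₀.toSubring →+* A.toSubring) =
      Ideal.comap (Subring.inclusion h₀) (maximalIdeal (O.comap (f : K →+* L))) := by
    ext a
    have h2 : Subring.inclusion hA (e a) = ⟨f a, hA (e a).2⟩ := Subtype.ext (he a)
    simp only [Ideal.mem_comap, hP, RingHom.coe_coe]
    rw [h2]
    exact (Lupi.mk_mem_maximalIdeal_comap_iff O (f : K →+* L) (h₀ a.2)).symm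
  haveI : (P.comap (e : A₀.toSubring →+* A.toSubring)).IsPrime := Ideal.comap_isPrime _ _
  exact isRegularLocalRing_localization_atPrime_congr hPe
    ((Lupi.isRegularLocalRing_localization_iff_of_ringEquiv e P).mp hreg)

/-- **`stub_relStep` of line `birth`, proved**: `FolLU → LogCanQuotLU → RelStep p` — one relative
descent step below a height-one simple sandwich `K ⊆ L = K(y)`, `y ^ p ∈ K`, keeping the given
finitely generated `R ⊆ K`: `D = d/dy` (`exists_derivation_heightOne`), `FolLU` refines `B` to
`S' ⊇ B ⊇ R`, `LogCanQuotLU` WITH `R.map f` returns `A ⊇ R` of constants, `Frac A = ker D = K`,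
regular at the centre; transport by `exists_model_comap_of_model`.
[cite: Temkin2013, Rem. 1.3.5 (ii)–(iii)] -/
theorem relStep_of_folLU_of_logCanQuotLU (hF : FolLU) (hQ : LogCanQuotLU) (p : ℕ)
    (hp : p.Prime) : RelStep p := by
  intro k K L _ _ _ _ _ _ _ _ _ _hpi hy O B hB R hBfg hBfr hBreg hRfg hRB
  classical
  haveI : Fact p.Prime := ⟨hp⟩
  haveI : CharP K p := charP_of_injective_algebraMap (algebraMap k K).injective p
  haveI := hBfr
  obtain ⟨y, hyp, htop⟩ := hy
  let f : K →ₐ[k] L := IsScalarTower.toAlgHom k K L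
  have hf : (f : K →+* L) = algebraMap K L := rfl
  -- the goal is stated with `algebraMap K L = (f : K →+* L)` (definitionally, `hf`)
  suffices H : ∃ (A : Subalgebra k K) (hA : A.toSubring ≤ (O.comap (f : K →+* L)).toSubring),
      R ≤ A ∧ A.FG ∧ IsFractionRing A K ∧
      IsRegularLocalRing (Localization.AtPrime
        (Ideal.comap (Subring.inclusion hA) (maximalIdeal (O.comap (f : K →+* L))))) by
    obtain ⟨A, hA, h1, h2, h3, h4⟩ := H
    exact ⟨A, hA, h1, h2, h3, h4⟩
  by_cases hyK : y ∈ (algebraMap K L).range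
  · -- degenerate case `L = K`: the regular-at-the-centre `B` itself
    have hsurj : Function.Surjective (algebraMap K L) := by
      intro z
      have hz : z ∈ (⊤ : IntermediateField K L) := IntermediateField.mem_top
      rw [← htop] at hz
      have hle : IntermediateField.adjoin K {y} ≤ ⊥ := by
        rw [IntermediateField.adjoin_le_iff]
        rintro _ rfl
        obtain ⟨c, hc⟩ := hyK
        exact hc ▸ (⊥ : IntermediateField K L).algebraMap_mem c
      obtain ⟨c, hc⟩ := IntermediateField.mem_bot.mp (hle hz)
      exact ⟨c, hc⟩
    refine exists_model_comap_of_model f O B hB (fun x _ => hsurj x) hBfg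
      (fun z => ?_) hBreg R hRB
    obtain ⟨a, b, hb, hab⟩ := IsFractionRing.div_surjective (A := B) (f z)
    exact ⟨a, b, a.2, b.2, fun h => nonZeroDivisors.ne_zero hb (Subtype.ext h), hab.symm⟩
  · -- the height-one step: `D = d/dy`
    obtain ⟨D, hDy, hDK, hDp, hDker⟩ := exists_derivation_heightOne k y hyK hyp htop
    have hD0 : D ≠ 0 := by
      intro h
      rw [h] at hDy
      exact zero_ne_one hDy
    have hDpc : ∃ c : L, ∀ x : L, (⇑D)^[p] x = c * D x := ⟨0, fun x => by rw [hDp, zero_mul]⟩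
    -- `FolLU`: refine `B` to `S' ⊇ B` with `g • D` non-singular or multiplicative
    obtain ⟨S', h', g, hBS', hS'fg, hS'fr, hS'reg, hg, hpres, hcases⟩ :=
      hF p hp k L O B hB D hBfg hBfr hBreg hD0 hDpc
    -- `LogCanQuotLU` with the GIVEN `R` (pushed into `L`)
    have hR'fg : (R.map f).FG := hRfg.map f
    have hR'le : R.map f ≤ S' := le_trans hRB hBS'
    have hR'const : ∀ x ∈ R.map f, D x = 0 := by
      intro x hx
      obtain ⟨r, -, rfl⟩ := Subalgebra.mem_map.mp hx
      exact hDK r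
    obtain ⟨A, hA, hRA, hAfg, hAconst, hAfrac, hAreg⟩ :=
      hQ p hp k L O S' h' D g (R.map f) hS'fg hS'fr hS'reg hD0 hDpc hg hpres hcases hR'fg hR'le
        hR'const
    -- `A ⊆ K`, `K ⊆ Frac A`: transport, keeping `R`
    refine exists_model_comap_of_model f O A hA (fun x hx => ?_) hAfg (fun z => ?_) hAreg R hRA
    · obtain ⟨c, hc⟩ := hDker x (hAconst x hx)
      exact ⟨c, hc⟩
    · obtain ⟨a, b, ha, hb, hb0, hz⟩ := hAfrac (f z) (hDK z)
      exact ⟨a, b, ha, hb, hb0, hz⟩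

end Summit.ResolutionOfSingularities.ResolutionOfSingularities.Theorems.DualSandwichRefuterEvidence

end
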